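/-
COR-CM (cell pub-hodgecm2, stage 2 of the Hodge ladder) — X_Γ-side «Albanese dictionary», classical form: CONSTANT versus
NON-CONSTANT morphisms `X → A_{(K,Ψ)}` of the model universe and `Hom(Alb X, A_{(K,Ψ)})` (ROUTES-B01 §7 L2-C).  Written by
the binder seat pub-hodgecm2-b10 (prover-pub-hodgecm2-b10-g17-0), count-neutral own lane (CLAIM ALBANESE-EXIST, 7), over
the Literature brick `Motives/AlbaneseConstantMorphisms`; sibling of `Geometry/MorphismsViaAlbanese` (the `U.pull F 1 ≠ 0`
form).  Theorems only; nothing cited as a record; nothing asserted; no binder row touched; nothing under `CorCM/B01/`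
(own-b01's pen) is edited, imported or restated.
-/
import Summits.HodgeConjecture.CorCM.Model.Universe
import Literature.AlgebraicGeometry.Motives.AlbaneseConstantMorphisms
import HarnessLib

/-!
# Constant and non-constant morphisms to `A_{(K,Ψ)}` (model universe)

ON THE MODEL UNIVERSE `U = Model.universeOf hHD hI hU h₃` (and the universe of record
`Model.picardCMUniverse hHD hI h₁ h₃`): for every variety `X` of the universe (smooth projective,
`Var.isSmoothProjective`), every CM pair `(K, Ψ)` and every Albanese datum `𝒥` of `X`:

* `pull_ne_zero_iff_forall_ne_const` — a morphism `F : X → A_{(K,Ψ)}` of the universe has `U.pull F 1 ≠ 0` iff it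
  is NON-CONSTANT; `pull_eq_zero_iff_exists_eq_const` — it kills `H¹(−; ℚ)` iff it is constant, `F = (X → Spec ℂ) ≫ a`
  (`Motives/AlbaneseConstantMorphisms`: `(f^P)^*` injective on `H¹(−; ℚ)`, the rational representation faithful,
  translations act trivially on cohomology);
* **`exists_mor_ne_const_iff_exists_hom_ne_zero`** — **`X` admits a NON-CONSTANT morphism to `A_{(K,Ψ)}` iff
  `Hom(Alb X, A_{(K,Ψ)}) ≠ 0`** (`Jacobian.exists_ne_const_iff_exists_hom_ne_zero`), and the contrapositive
  `forall_mor_exists_eq_const_iff_forall_hom_eq_zero`;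
* the `picardCMUniverse_…` twins.

USE (junction B01): with own-b01's `FaceSupply ↔ FaceAlbaneseReach` (`B01/FaceSupplyAlbanese`) and the sibling
`Geometry/MorphismsViaAlbanese`, the supply input B01-S reads, in the language of the print literature,
«for every face datum some `P_Γ` maps NON-CONSTANTLY to `A_{(F,ψ₀)}` and to `A_{(F,ψ₁)}`» ⟺ «`A_{(F,ψ₀)}`, `A_{(F,ψ₁)}`
meet `Alb(P_Γ)`» (Murty–Ramakrishnan 1992; [Liu2021] Cor. 4.20).
-/

noncomputable section

open CategoryTheory AlgebraicGeometry

namespace Summit.HodgeConjecture.CorCM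

open Literature.AlgebraicGeometry.Motives
open Literature.AlgebraicGeometry.HodgeTheory
open Literature.NumberTheory.Automorphic.PicardCM

namespace Model

section NonConstant

variable {hHD : exists_isReal_hodgeModel} {hI : hodgePQ_independent_of_hodgeModel}
  {hU : BallQuotientUniformisedDatum} {h₃ : CMAbelianVarietyRealised}
variable (X : Var) (K : CMField) (Ψ : CMType K) (𝒥 : Jacobian (Var.scheme hU h₃ X))

/-- **A morphism `F : X → A_{(K,Ψ)}` of the universe has `U.pull F 1 ≠ 0` iff it is non-constant**
(`hom_bettiCohomology_map_one_ne_zero_iff_forall_ne_const`). -/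
theorem pull_ne_zero_iff_forall_ne_const (F : (universeOf hHD hI hU h₃).Mor X ((universeOf hHD hI hU h₃).cmAV K Ψ)) :
    (universeOf hHD hI hU h₃).pull F 1 ≠ 0 ↔
      ∀ a : (cmRealisation h₃ (cmCode K Ψ)).AV.Points ℂ, F ≠ toSpecOver (Var.scheme hU h₃ X) ≫ a :=
  hom_bettiCohomology_map_one_ne_zero_iff_forall_ne_const (cmRealisation h₃ (cmCode K Ψ)).AV
    (Var.isSmoothProjective hU h₃ X) F

/-- **A morphism `F : X → A_{(K,Ψ)}` of the universe kills `H¹(−; ℚ)` iff it is constant**: through a point,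
`F = (X → Spec ℂ) ≫ a` (`hom_bettiCohomology_map_one_eq_zero_iff_exists_eq_const`). -/
theorem pull_eq_zero_iff_exists_eq_const (F : (universeOf hHD hI hU h₃).Mor X ((universeOf hHD hI hU h₃).cmAV K Ψ)) :
    (universeOf hHD hI hU h₃).pull F 1 = 0 ↔
      ∃ a : (cmRealisation h₃ (cmCode K Ψ)).AV.Points ℂ, F = toSpecOver (Var.scheme hU h₃ X) ≫ a :=
  hom_bettiCohomology_map_one_eq_zero_iff_exists_eq_const (cmRealisation h₃ (cmCode K Ψ)).AV
    (Var.isSmoothProjective hU h₃ X) F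

/-- **The classical dictionary on the model universe**: `X` admits a NON-CONSTANT morphism to `A_{(K,Ψ)}` iff
`Hom(Alb X, A_{(K,Ψ)}) ≠ 0` (`Jacobian.exists_ne_const_iff_exists_hom_ne_zero`). -/
theorem exists_mor_ne_const_iff_exists_hom_ne_zero :
    (∃ F : (universeOf hHD hI hU h₃).Mor X ((universeOf hHD hI hU h₃).cmAV K Ψ),
        ∀ a : (cmRealisation h₃ (cmCode K Ψ)).AV.Points ℂ, F ≠ toSpecOver (Var.scheme hU h₃ X) ≫ a) ↔
      ∃ u : 𝒥.J ⟶ (cmRealisation h₃ (cmCode K Ψ)).AV, u ≠ 0 :=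
  𝒥.exists_ne_const_iff_exists_hom_ne_zero (cmRealisation h₃ (cmCode K Ψ)).AV (Var.isSmoothProjective hU h₃ X)

/-- Contrapositive form: every morphism `X → A_{(K,Ψ)}` of the universe is constant iff
`Hom(Alb X, A_{(K,Ψ)}) = 0`. -/
theorem forall_mor_exists_eq_const_iff_forall_hom_eq_zero :
    (∀ F : (universeOf hHD hI hU h₃).Mor X ((universeOf hHD hI hU h₃).cmAV K Ψ),
        ∃ a : (cmRealisation h₃ (cmCode K Ψ)).AV.Points ℂ, F = toSpecOver (Var.scheme hU h₃ X) ≫ a) ↔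
      ∀ u : 𝒥.J ⟶ (cmRealisation h₃ (cmCode K Ψ)).AV, u = 0 :=
  𝒥.forall_exists_eq_const_iff_forall_hom_eq_zero (cmRealisation h₃ (cmCode K Ψ)).AV
    (Var.isSmoothProjective hU h₃ X)

end NonConstant

section NonConstantPicardCM

variable {hHD : exists_isReal_hodgeModel} {hI : hodgePQ_independent_of_hodgeModel}
  {h₁ : BallQuotientUniformised} {h₃ : CMAbelianVarietyRealised}
variable (X : Var) (K : CMField) (Ψ : CMType K)
  (𝒥 : Jacobian (Var.scheme (ballQuotientUniformisedDatum_of h₁) h₃ X))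

/-- `pull_ne_zero_iff_forall_ne_const` on the universe of record. -/
theorem picardCMUniverse_pull_ne_zero_iff_forall_ne_const
    (F : (picardCMUniverse hHD hI h₁ h₃).Mor X ((picardCMUniverse hHD hI h₁ h₃).cmAV K Ψ)) :
    (picardCMUniverse hHD hI h₁ h₃).pull F 1 ≠ 0 ↔
      ∀ a : (cmRealisation h₃ (cmCode K Ψ)).AV.Points ℂ,
        F ≠ toSpecOver (Var.scheme (ballQuotientUniformisedDatum_of h₁) h₃ X) ≫ a :=
  pull_ne_zero_iff_forall_ne_const X K Ψ F

/-- **The classical dictionary on the universe of record**: `X` admits a non-constant morphism to `A_{(K,Ψ)}`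
iff `Hom(Alb X, A_{(K,Ψ)}) ≠ 0`. -/
theorem picardCMUniverse_exists_mor_ne_const_iff_exists_hom_ne_zero :
    (∃ F : (picardCMUniverse hHD hI h₁ h₃).Mor X ((picardCMUniverse hHD hI h₁ h₃).cmAV K Ψ),
        ∀ a : (cmRealisation h₃ (cmCode K Ψ)).AV.Points ℂ,
          F ≠ toSpecOver (Var.scheme (ballQuotientUniformisedDatum_of h₁) h₃ X) ≫ a) ↔
      ∃ u : 𝒥.J ⟶ (cmRealisation h₃ (cmCode K Ψ)).AV, u ≠ 0 :=
  exists_mor_ne_const_iff_exists_hom_ne_zero X K Ψ 𝒥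

end NonConstantPicardCM

end Model

end Summit.HodgeConjecture.CorCM

end
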